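import Summits.HodgeConjecture.HodgeConjecture.Theses.SupersingularIsotypicLift
import Literature.AlgebraicGeometry.HodgeTheory.MotivatedClasses

/-!
# Birth skeleton (BC3) — crux `IsotypicClassesAlgebraic` (LIFT) of route `SupersingularIsotypicLift`

Crux item `stmt-HodgeConjecture-3048`, decl
`Summit.HodgeConjecture.HodgeConjecture.Theses.SupersingularIsotypicLift.IsotypicClassesAlgebraic`
(LIFT): for every orientation family `μ` with Poincaré duality, every smooth projective complex `X`
(dim `n`), every `p` and every `γ ∈ algebraicClasses (X ⊗ X) n` whose correspondence action
`P β = pr₁₊(pr₂* β ∪ γ)` preserves rational classes and has image consisting of `(p,p)`-classes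
("`P` envelopes the piece `N = P(H²ᵖ(X,ℚ))`, `N ⊗ ℂ ⊂ H^{p,p}`"), every RATIONAL class `c` with
`P c = c` lies in `algebraicClasses X p`.

## The seam (André's motivated classes: the anchor-lift made archimedean, the `B`-debt isolated)

`A(X) ⊆ A_mot(X) ⊆ Hdg(X) ⊗ ℂ` (algebraic ⊆ motivated ⊆ Hodge; André 1996 §2.1 remark, Prop. 2.5.1;
the tree's REAL-carrier `Literature.AlgebraicGeometry.HodgeTheory.motivatedClasses n X p ⊆ H²ᵖ(X(ℂ); ℂ)`).
An enveloped rational class `c = P c` is automatically a rational `(p,p)`-class, so LIFT is "HC on the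
enveloped pieces"; it factors at the middle term:

* `stub_envelopedClassesMotivated` — **ENVELOPED CLASSES ARE MOTIVATED** (the line's bet, `B`-free):
  same binders and hypotheses as the crux, conclusion `c ∈ motivatedClasses n X p` instead of
  `c ∈ algebraicClasses X p` (statement: `Sig.stub_envelopedClassesMotivated`). KNOWN on the route's
  anchored families: for every complex abelian variety (André 1996 Thm. 0.6.2 = the tree's named fact
  `Andre1996_hodgeClasses_abelianVariety_motivated`: ALL Hodge classes there are motivated — so the
  stub holds for every CM abelian variety and every Hodge–Weil envelope, where LIFT itself is open),
  and in print for abelian-type motives such as the Fermat hypersurfaces `X^n_m` (dominated by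
  products of Fermat curves, Shioda–Katsura; functoriality André Prop. 2.1). MECHANISM toward the
  general case: André's deformation theorem 0.5 (Principle B for motivated classes, UNCONDITIONAL;
  tree named fact `Andre1996_deformation`) propagates motivatedness of an enveloped piece along every
  family over which `γ` stays algebraic, from an anchor fibre where the piece is algebraic — the
  archimedean twin of the route's supersingular-anchor lift (there: Bloch–Esnault–Kerz Thm. 1.3 + ALG
  at a supersingular prime; here: André 0.5, no algebraization input, but landing in `A_mot`, not `A`).
  Open exactly where "Hodge ⇒ motivated" (André §0.4) is: rigid `X` beyond abelian type.
* `stub_motivatedClassesAlgebraic` — **MOTIVATED CLASSES ARE ALGEBRAIC**, `A_motᵖ(X)_ℂ ≤ Nᵖ H²ᵖ` for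
  every smooth projective `X` and every `p`: André's "`A_mot(X) = A(X)` si … l'involution de Lefschetz
  est donnée par une correspondance algébrique" (§2.1 remark) — of standard-conjecture-`B` strength
  (for all `X` it is EQUIVALENT to Grothendieck's `B` for all `X`, given multiplicativity of algebraic
  classes, Voisin II Prop. 9.20); in the tree: named fact
  `Andre1996_motivatedClasses_le_algebraicClasses_of_standardConjectureB`, reduced in
  `MotivatedClassesProofs` / `MotivatedClassesAssembly` to `StandardConjectureBStar` + Voisin II 9.20.
  Open even for abelian `X` (the auxiliary varieties leave the abelian world).

`IsotypicClassesAlgebraic_of : Sig.stub_envelopedClassesMotivated → Sig.stub_motivatedClassesAlgebraic →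
IsotypicClassesAlgebraic` is the real (sorry-free) composition `c ∈ A_mot ≤ A` (the statements of the
stubs are the `def`s `Sig.stub_<name> : Prop`, named after the stubs so that the skeleton audit admits
them as hypotheses by name), and `IsotypicClassesAlgebraic_of_stubs` instantiates it at the two sorried
stubs.

Neither stub alone gives the crux (stub 1 lands in `A_mot`, not `A`; stub 2 says nothing about
enveloped classes that are not yet known motivated) nor the summit `HodgeConjecture`; both are
consequences of `HodgeConjecture` (HC ⇒ `A = A_mot = Hdg ⊗ ℂ`), i.e. consequences used toward `S`.
BC3 probes (`stub → IsotypicClassesAlgebraic`, `stub → HodgeConjecture` by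
`first | exact? | simpa [·] | (unfold ·; simpa) | aesop`) are run in the sibling probe files and must
fail. The p-adic mechanism of the route (supersingular span + BEK Thm. 1.3 + ALG, items 3116 / 3213 /
3217, informal) attacks `stub 2 ∘ stub 1` directly on anchored pieces and bypasses `B`; its typed line
awaits ALG's signature and the crystalline/isotypic comparison vocabulary, and is to be registered as
a separate `Lines/<slug>.lean` by a crux-plan seat.
-/

namespace Summit.HodgeConjecture.HodgeConjecture.Cruxes.IsotypicClassesAlgebraic.Birth

open Summit.HodgeConjecture.HodgeConjecture.Theses.SupersingularIsotypicLift

/-- **Stub 1 statement — enveloped classes are motivated (the bet, `B`-free).** Same binders as the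
crux `IsotypicClassesAlgebraic` VERBATIM (orientation family `μ` with Poincaré duality, smooth
projective `X` of dimension `n`, `p`, `γ ∈ algebraicClasses (X ⊗ X) n`, the inlined correspondence
action `P β = pr₁₊(pr₂* β ∪ γ)` with `pr₁₊ = complexGysin μ`, `P` preserving rational classes and
`(p,p)`-imaged, `c` rational with `P c = c`); conclusion: `c` is a MOTIVATED class,
`c ∈ motivatedClasses n X p = A_motᵖ(X)_ℂ` (André 1996 Déf. 1 on the real carriers). Known for abelian
varieties (André Thm. 0.6.2) and abelian-type motives (Fermat hypersurfaces); open in general.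
[cite: Andre1996Motifs, Thm. 0.6.2 and Thm. 0.5] -/
def Sig.stub_envelopedClassesMotivated : Prop :=
  ∀ (μ : Literature.AlgebraicGeometry.HodgeTheory.OrientationFamily), μ.HasPoincareDuality → ∀ ⦃n : ℕ⦄ ⦃X : Literature.AlgebraicGeometry.Motives.SchemeOver ℂ⦄ (hX : Literature.AlgebraicGeometry.Motives.IsSmoothProjective n X) (p : ℕ) (γ : Literature.AlgebraicGeometry.HodgeTheory.complexBetti (CategoryTheory.MonoidalCategoryStruct.tensorObj X X) (2 * n)), γ ∈ Literature.AlgebraicGeometry.HodgeTheory.algebraicClasses (CategoryTheory.MonoidalCategoryStruct.tensorObj X X) n → let P : Literature.AlgebraicGeometry.HodgeTheory.complexBetti X (2 * p) → Literature.AlgebraicGeometry.HodgeTheory.complexBetti X (2 * p) := fun β => Literature.AlgebraicGeometry.HodgeTheory.complexGysin μ (Literature.AlgebraicGeometry.Motives.IsSmoothProjective.tensor_holds hX hX) hX (CategoryTheory.CartesianMonoidalCategory.fst X X) (show 2 * p + 2 * n + 2 * n = 2 * p + 2 * (n + n) by ring) (Literature.AlgebraicTopology.SingularHomology.cupProduct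 (rfl : 2 * p + 2 * n = 2 * p + 2 * n) (Literature.AlgebraicGeometry.HodgeTheory.complexBetti.map (CategoryTheory.CartesianMonoidalCategory.snd X X) (2 * p) β) γ); (∀ β, Literature.AlgebraicGeometry.HodgeTheory.IsRationalClass β → Literature.AlgebraicGeometry.HodgeTheory.IsRationalClass (P β)) → (∀ β, Literature.AlgebraicGeometry.HodgeTheory.IsOfHodgeType n X (2 * p) p p (P β)) → ∀ c, Literature.AlgebraicGeometry.HodgeTheory.IsRationalClass c → P c = c → c ∈ Literature.AlgebraicGeometry.HodgeTheory.motivatedClasses n X p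

/-- **Stub 2 statement — motivated classes are algebraic** (André 1996, §2.1 remark following Déf. 1:
`A_mot(X) = A(X)` as soon as the Lefschetz involutions are algebraic): for every smooth projective
complex `X` of dimension `n` and every `p`, `A_motᵖ(X)_ℂ = motivatedClasses n X p ≤ algebraicClasses X p
= Nᵖ H²ᵖ(X(ℂ); ℂ)`. Of standard-conjecture-`B` strength (tree: named fact
`Andre1996_motivatedClasses_le_algebraicClasses_of_standardConjectureB`, reduced to
`StandardConjectureBStar` for all `Z` + Voisin II Prop. 9.20 in `MotivatedClassesAssembly`); open.
[cite: Andre1996Motifs, §2.1 remark following Déf. 1 (p. 14) and §0.3] [cite: Grothendieck1968, §3 p. 196] -/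
def Sig.stub_motivatedClassesAlgebraic : Prop :=
  ∀ ⦃n : ℕ⦄ ⦃X : Literature.AlgebraicGeometry.Motives.SchemeOver ℂ⦄,
    Literature.AlgebraicGeometry.Motives.IsSmoothProjective n X → ∀ p : ℕ,
      Literature.AlgebraicGeometry.HodgeTheory.motivatedClasses n X p ≤
        Literature.AlgebraicGeometry.HodgeTheory.algebraicClasses X p

/-- Stub 1 (the bet): enveloped rational classes are motivated. [cite: Andre1996Motifs, Thm. 0.6.2 and Thm. 0.5] -/
theorem stub_envelopedClassesMotivated : Sig.stub_envelopedClassesMotivated := by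
  sorry

/-- Stub 2: motivated classes are algebraic (standard-conjecture-`B` strength; André 1996 §2.1).
[cite: Andre1996Motifs, §2.1 remark following Déf. 1 (p. 14)] -/
theorem stub_motivatedClassesAlgebraic : Sig.stub_motivatedClassesAlgebraic := by
  sorry

/-- **Composition (real proof).** An enveloped rational class is motivated (stub 1) and motivated
classes are algebraic on the smooth projective `X` (stub 2): `c ∈ A_motᵖ(X)_ℂ ≤ algebraicClasses X p`.
Concludes the route decl `IsotypicClassesAlgebraic` BY NAME. -/
theorem IsotypicClassesAlgebraic_of :
    Sig.stub_envelopedClassesMotivated → Sig.stub_motivatedClassesAlgebraic → IsotypicClassesAlgebraic := by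
  intro h1 h2 μ hμ n X hX p γ hγ P hrat hhodge c hc hfix
  -- `P` is the crux's `let`-bound correspondence action; `h1 …` sees through it by `ζδ`-reduction.
  exact h2 hX p (h1 μ hμ hX p γ hγ hrat hhodge c hc hfix)

/-- **The line concludes the crux** (the composition instantiated at the two declared stubs; `sorry`
occurs only inside `stub_envelopedClassesMotivated`, `stub_motivatedClassesAlgebraic`). -/
theorem IsotypicClassesAlgebraic_of_stubs : IsotypicClassesAlgebraic :=
  IsotypicClassesAlgebraic_of stub_envelopedClassesMotivated stub_motivatedClassesAlgebraic

end Summit.HodgeConjecture.HodgeConjecture.Cruxes.IsotypicClassesAlgebraic.Birth
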